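import Summits.AtomisticToContinuum.Crystallization.Theorems.FreeSplittingCertificatesStrictSplittingRuleTorusModel552CovA

/-!
# Torus model 5×5×2: the covariance CHECK for parity B

Route `FreeSplittingCertificates`, crux `StrictSplittingRule` (stmt-AtomisticToContinuum-12560); unit b2b-freesplit-B (block 2b,
PART B, gen 1).  VALUE = theorem about a FINITE model — NOT summit progress.  See `…TorusModel552CovA.lean` and
`…TorusModel552AllSites.lean`.  COMPUTATIONAL (`native_decide`). [folklore]
-/

namespace Summit.AtomisticToContinuum.Crystallization.Theorems.StrictSplittingRuleTorusLMI

/-- **Covariance check, 5×5×2 parity B.**  COMPUTATIONAL (`native_decide`). -/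
theorem cov5B_check : ∀ g ∈ evenShifts5,
    siteTermLists5 (taddG 4 5 siteB5 g) = (siteTermLists5 siteB5).map fun ts => ts.map (shiftTermN (shiftIdx5 g)) := by
  native_decide

end Summit.AtomisticToContinuum.Crystallization.Theorems.StrictSplittingRuleTorusLMI
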